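/-
VALUE = THEOREM, NOT summit progress (cell b2b-lgcu-borel, gen 21); crux 14079 untouched.
-/
import Mathlib
import Summits.MatrixMultiplication.MatrixMultiplication.Theorems.SubgroupIdentityDesigns.Negative.ProductObstruction
import Summits.MatrixMultiplication.MatrixMultiplication.Theorems.SubgroupIdentityDesigns.Negative.ConjugationTransport
import Summits.MatrixMultiplication.MatrixMultiplication.Theorems.SubgroupIdentityDesigns.Negative.TransvectionPair
import Summits.MatrixMultiplication.MatrixMultiplication.Theorems.SubgroupIdentityDesigns.Negative.LineStabilizer

/-!
# Pair exclusions under conjugation; transvection groups with ANY two distinct centres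

VALUE = THEOREM (valid for every `p`, `m ≥ 3`, `ε`), NOT summit progress.

`ProductObstruction.no_design_of_disjoint₁₂/₂₃` excludes a level-one identity design as soon as
two adjacent members carry linear characters with DISJOINT admissible sets.  This file records
the two obvious but useful functorialities of that criterion and cashes them in:

* **sub-pairs** (`no_design_of_disjoint_le₁₂/₂₃`): it suffices that the members CONTAIN subgroups
  `K₁ ≤ H₁`, `K₂ ≤ H₂` with disjoint admissible sets (the criterion is monotone);
* **simultaneous conjugation** (`disjoint_adm_conj`, `no_design_of_disjoint_conj₁₂/₂₃`):
  `adm(x K x⁻¹, σ^x) = x · adm(K, σ)`, so disjointness survives conjugating both subgroups by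
  the same `x ∈ GL_m(𝔽_p)`;
* **transvection groups with arbitrary distinct centres** (`no_design_of_centres₁₂/₂₃`): for
  `m ≥ 3` and any two linearly independent vectors `v₁, v₂`, no subgroup TPP triple carrying a
  level-one design has two adjacent members containing the full transvection groups
  `T(v₁) = {1 + v₁ ⊗ ψ : ψ(v₁) = 0}` and `T(v₂)` (the coordinate case `v = e_{i}` is
  `TransvectionPair.no_design_of_transl₁₂`; `GL_m` is transitive on independent pairs,
  `LineStabilizer.exists_GL_pair`, and `x T(e_{i₀}) x⁻¹ = T(x e_{i₀})`, `conj_translGroup_le`).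
  Equal centres are excluded by the TPP itself (`T(v) ≤ H₁ ∩ H₂`).  In particular **no two
  adjacent members both contain a Sylow `p`-subgroup of `GL_m(𝔽_p)`** (`m ≥ 3`): a conjugate of
  the unitriangular group contains `T(x e₀)`.  By `DualityTransport` the same holds for the full
  transvection groups with two distinct AXES.

HONEST SCOPE.  Exclusions of member configurations; no `(p,m,ε)` cell is emptied.
-/

set_option linter.dupNamespace false

noncomputable section

open scoped BigOperators Matrix Classical
open Literature.Barriers.MatrixMultiplication (SubgroupTPP)
open Summit.MatrixMultiplication.MatrixMultiplication.Theorems.LieRankDesigns.Negative (GLm Mat)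

namespace Summit.MatrixMultiplication.MatrixMultiplication.Theorems.SubgroupIdentityDesigns.Negative
namespace TransvectionLines

open LevelOneEquivariantDim (adm mem_adm smul_mem_adm)
open ConjugationTransport (conjSubgroup mem_conjSubgroup conjChar inv_smul_mem_adm)
open ProductObstruction (no_design_of_disjoint₁₂ no_design_of_disjoint₂₃)
open TransvectionPair (nil translGroup trChar disjoint_adm_transl)

variable {p m : ℕ} [hp : Fact p.Prime]

/-! ## Functoriality of the pair criterion -/

section Functorial

variable {K₁ K₂ H₁ H₂ H₃ : Subgroup (GLm p m)} {σ₁ : K₁ →* ℂˣ} {σ₂ : K₂ →* ℂˣ}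

/-- Disjointness of admissible sets survives simultaneous conjugation. -/
theorem disjoint_adm_conj (x : GLm p m) (h : Disjoint (adm K₁ σ₁) (adm K₂ σ₂)) :
    Disjoint (adm (conjSubgroup K₁ x) (conjChar K₁ σ₁ x))
      (adm (conjSubgroup K₂ x) (conjChar K₂ σ₂ x)) :=
  Set.disjoint_left.2 fun _ h₁ h₂ =>
    Set.disjoint_left.1 h (inv_smul_mem_adm h₁) (inv_smul_mem_adm h₂)

/-- **Sub-pair criterion, members 1–2**: subgroups `K₁ ≤ H₁`, `K₂ ≤ H₂` with disjoint admissible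
sets exclude a level-one identity design on `(H₁, H₂, H₃)`. -/
theorem no_design_of_disjoint_le₁₂ (hdisj : Disjoint (adm K₁ σ₁) (adm K₂ σ₂))
    (htpp : SubgroupTPP H₁ H₂ H₃) (hK₁ : K₁ ≤ H₁) (hK₂ : K₂ ≤ H₂) :
    ¬ ∃ c : Mat p m → ℂ, (∀ M, 1 < M.rank → c M = 0) ∧
      (∑ M, c M * ZMod.stdAddChar (Matrix.trace (M * ((1 : GLm p m) : Mat p m)))) = 1 ∧
      ∀ a ∈ H₁, ∀ b ∈ H₂, ∀ g ∈ H₃, a * b * g ≠ 1 →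
        (∑ M, c M * ZMod.stdAddChar (Matrix.trace (M * ((a * b * g : GLm p m) : Mat p m)))) = 0 := by
  rintro ⟨c, hc, h1, h0⟩
  have htpp' : SubgroupTPP K₁ K₂ H₃ := fun a ha b hb g hg habg =>
    htpp a (hK₁ ha) b (hK₂ hb) g hg habg
  exact no_design_of_disjoint₁₂ htpp' σ₁ σ₂ hdisj
    ⟨c, hc, h1, fun a ha b hb g hg hne => h0 a (hK₁ ha) b (hK₂ hb) g hg hne⟩

/-- **Sub-pair criterion, members 2–3.** -/
theorem no_design_of_disjoint_le₂₃ (hdisj : Disjoint (adm K₁ σ₁) (adm K₂ σ₂))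
    (htpp : SubgroupTPP H₁ H₂ H₃) (hK₂ : K₁ ≤ H₂) (hK₃ : K₂ ≤ H₃) :
    ¬ ∃ c : Mat p m → ℂ, (∀ M, 1 < M.rank → c M = 0) ∧
      (∑ M, c M * ZMod.stdAddChar (Matrix.trace (M * ((1 : GLm p m) : Mat p m)))) = 1 ∧
      ∀ a ∈ H₁, ∀ b ∈ H₂, ∀ g ∈ H₃, a * b * g ≠ 1 →
        (∑ M, c M * ZMod.stdAddChar (Matrix.trace (M * ((a * b * g : GLm p m) : Mat p m)))) = 0 := by
  rintro ⟨c, hc, h1, h0⟩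
  have htpp' : SubgroupTPP H₁ K₁ K₂ := fun a ha b hb g hg habg =>
    htpp a ha b (hK₂ hb) g (hK₃ hg) habg
  exact no_design_of_disjoint₂₃ htpp' σ₁ σ₂ hdisj
    ⟨c, hc, h1, fun a ha b hb g hg hne => h0 a ha b (hK₂ hb) g (hK₃ hg) hne⟩

/-- **Conjugated sub-pair criterion, members 1–2**: `x K₁ x⁻¹ ≤ H₁`, `x K₂ x⁻¹ ≤ H₂`. -/
theorem no_design_of_disjoint_conj₁₂ (hdisj : Disjoint (adm K₁ σ₁) (adm K₂ σ₂)) (x : GLm p m)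
    (htpp : SubgroupTPP H₁ H₂ H₃) (hK₁ : conjSubgroup K₁ x ≤ H₁)
    (hK₂ : conjSubgroup K₂ x ≤ H₂) :
    ¬ ∃ c : Mat p m → ℂ, (∀ M, 1 < M.rank → c M = 0) ∧
      (∑ M, c M * ZMod.stdAddChar (Matrix.trace (M * ((1 : GLm p m) : Mat p m)))) = 1 ∧
      ∀ a ∈ H₁, ∀ b ∈ H₂, ∀ g ∈ H₃, a * b * g ≠ 1 →
        (∑ M, c M * ZMod.stdAddChar (Matrix.trace (M * ((a * b * g : GLm p m) : Mat p m)))) = 0 :=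
  no_design_of_disjoint_le₁₂ (disjoint_adm_conj x hdisj) htpp hK₁ hK₂

/-- **Conjugated sub-pair criterion, members 2–3.** -/
theorem no_design_of_disjoint_conj₂₃ (hdisj : Disjoint (adm K₁ σ₁) (adm K₂ σ₂)) (x : GLm p m)
    (htpp : SubgroupTPP H₁ H₂ H₃) (hK₂ : conjSubgroup K₁ x ≤ H₂)
    (hK₃ : conjSubgroup K₂ x ≤ H₃) :
    ¬ ∃ c : Mat p m → ℂ, (∀ M, 1 < M.rank → c M = 0) ∧
      (∑ M, c M * ZMod.stdAddChar (Matrix.trace (M * ((1 : GLm p m) : Mat p m)))) = 1 ∧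
      ∀ a ∈ H₁, ∀ b ∈ H₂, ∀ g ∈ H₃, a * b * g ≠ 1 →
        (∑ M, c M * ZMod.stdAddChar (Matrix.trace (M * ((a * b * g : GLm p m) : Mat p m)))) = 0 :=
  no_design_of_disjoint_le₂₃ (disjoint_adm_conj x hdisj) htpp hK₂ hK₃

end Functorial

/-! ## Transvection groups with arbitrary centres -/

section Centres

variable (i₀ : Fin m)

/-- `x T(e_{i₀}) x⁻¹ ≤ H` as soon as `H` contains every transvection `1 + v ⊗ ψ` (`ψ(v) = 0`)
with centre `v = x e_{i₀}`:  indeed `x (1 + e_{i₀} ⊗ φ) x⁻¹ = 1 + (x e_{i₀}) ⊗ (φ x⁻¹)`. -/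
theorem conj_translGroup_le {x : GLm p m} {v : Fin m → ZMod p}
    (hx : (x : Mat p m) *ᵥ Pi.single i₀ 1 = v) {H : Subgroup (GLm p m)}
    (hH : ∀ ψ : Fin m → ZMod p, ψ ⬝ᵥ v = 0 →
      ∃ g ∈ H, (g : Mat p m) = 1 + Matrix.vecMulVec v ψ) :
    conjSubgroup (translGroup i₀) x ≤ H := by
  intro g hg
  obtain ⟨k, ⟨φ, hφ, hk⟩, rfl⟩ := mem_conjSubgroup.1 hg
  -- the conjugate is the transvection `1 + v ⊗ ψ` with `ψ = φ x⁻¹`, and `ψ(v) = φ(e_{i₀}) = 0`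
  have hψ : (φ ᵥ* ((x⁻¹ : GLm p m) : Mat p m)) ⬝ᵥ v = 0 := by
    rw [← Matrix.dotProduct_mulVec, ← hx, Matrix.mulVec_mulVec, ← Units.val_mul, inv_mul_cancel,
      Units.val_one, Matrix.one_mulVec, dotProduct_single, mul_one, hφ]
  obtain ⟨g, hgH, hg⟩ := hH _ hψ
  have hkg : x * (k : GLm p m) * x⁻¹ = g := by
    apply Units.ext
    rw [hg, Units.val_mul, Units.val_mul, hk, mul_add, mul_one, add_mul, Units.mul_inv, nil,
      Matrix.mul_vecMulVec, hx, Matrix.vecMulVec_mul]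
  rw [hkg]
  exact hgH

end Centres

section Exclusion

variable {H₁ H₂ H₃ : Subgroup (GLm p m)}

/-- `e_{i}` and `e_{j}` are linearly independent for `i ≠ j`. -/
theorem linearIndependent_single {i j : Fin m} (h : i ≠ j) :
    LinearIndependent (ZMod p)
      ![(Pi.single i 1 : Fin m → ZMod p), (Pi.single j 1 : Fin m → ZMod p)] := by
  rw [LinearIndependent.pair_iff]
  intro s t hst
  have h0 := congr_fun hst i
  have h1 := congr_fun hst j
  simp only [Pi.add_apply, Pi.smul_apply, Pi.single_apply, if_true, if_neg h, if_neg h.symm,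
    smul_eq_mul, mul_one, mul_zero, add_zero, zero_add, Pi.zero_apply] at h0 h1
  exact ⟨h0, h1⟩

/-- **TRANSVECTION GROUPS WITH ANY TWO DISTINCT CENTRES, members 1–2** (`m ≥ 3`): if `v₁, v₂`
are linearly independent and `H₁ ⊇ T(v₁)`, `H₂ ⊇ T(v₂)` (all transvections `1 + vᵢ ⊗ ψ`,
`ψ(vᵢ) = 0`), then no subgroup TPP triple `(H₁, H₂, H₃)` carries a level-one identity design. -/
theorem no_design_of_centres₁₂ (hm : 3 ≤ m) {v₁ v₂ : Fin m → ZMod p}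
    (hv : LinearIndependent (ZMod p) ![v₁, v₂]) (htpp : SubgroupTPP H₁ H₂ H₃)
    (hH₁ : ∀ ψ : Fin m → ZMod p, ψ ⬝ᵥ v₁ = 0 →
      ∃ g ∈ H₁, (g : Mat p m) = 1 + Matrix.vecMulVec v₁ ψ)
    (hH₂ : ∀ ψ : Fin m → ZMod p, ψ ⬝ᵥ v₂ = 0 →
      ∃ g ∈ H₂, (g : Mat p m) = 1 + Matrix.vecMulVec v₂ ψ) :
    ¬ ∃ c : Mat p m → ℂ, (∀ M, 1 < M.rank → c M = 0) ∧
      (∑ M, c M * ZMod.stdAddChar (Matrix.trace (M * ((1 : GLm p m) : Mat p m)))) = 1 ∧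
      ∀ a ∈ H₁, ∀ b ∈ H₂, ∀ g ∈ H₃, a * b * g ≠ 1 →
        (∑ M, c M * ZMod.stdAddChar (Matrix.trace (M * ((a * b * g : GLm p m) : Mat p m)))) = 0 := by
  set i₀ : Fin m := ⟨0, by omega⟩
  set i₁ : Fin m := ⟨1, by omega⟩
  set i₂ : Fin m := ⟨2, by omega⟩
  have h01 : i₀ ≠ i₁ := fun h => by simp [i₀, i₁, Fin.ext_iff] at h
  have h02 : i₀ ≠ i₂ := fun h => by simp [i₀, i₂, Fin.ext_iff] at h
  have h12 : i₁ ≠ i₂ := fun h => by simp [i₁, i₂, Fin.ext_iff] at h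
  obtain ⟨x, hx₀, hx₁⟩ := LineStabilizer.exists_GL_pair (linearIndependent_single h01) hv
  exact no_design_of_disjoint_conj₁₂ (disjoint_adm_transl h01 h02 h12) x htpp
    (conj_translGroup_le i₀ hx₀ hH₁) (conj_translGroup_le i₁ hx₁ hH₂)

/-- **TRANSVECTION GROUPS WITH ANY TWO DISTINCT CENTRES, members 2–3** (`m ≥ 3`). -/
theorem no_design_of_centres₂₃ (hm : 3 ≤ m) {v₁ v₂ : Fin m → ZMod p}
    (hv : LinearIndependent (ZMod p) ![v₁, v₂]) (htpp : SubgroupTPP H₁ H₂ H₃)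
    (hH₂ : ∀ ψ : Fin m → ZMod p, ψ ⬝ᵥ v₁ = 0 →
      ∃ g ∈ H₂, (g : Mat p m) = 1 + Matrix.vecMulVec v₁ ψ)
    (hH₃ : ∀ ψ : Fin m → ZMod p, ψ ⬝ᵥ v₂ = 0 →
      ∃ g ∈ H₃, (g : Mat p m) = 1 + Matrix.vecMulVec v₂ ψ) :
    ¬ ∃ c : Mat p m → ℂ, (∀ M, 1 < M.rank → c M = 0) ∧
      (∑ M, c M * ZMod.stdAddChar (Matrix.trace (M * ((1 : GLm p m) : Mat p m)))) = 1 ∧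
      ∀ a ∈ H₁, ∀ b ∈ H₂, ∀ g ∈ H₃, a * b * g ≠ 1 →
        (∑ M, c M * ZMod.stdAddChar (Matrix.trace (M * ((a * b * g : GLm p m) : Mat p m)))) = 0 := by
  set i₀ : Fin m := ⟨0, by omega⟩
  set i₁ : Fin m := ⟨1, by omega⟩
  set i₂ : Fin m := ⟨2, by omega⟩
  have h01 : i₀ ≠ i₁ := fun h => by simp [i₀, i₁, Fin.ext_iff] at h
  have h02 : i₀ ≠ i₂ := fun h => by simp [i₀, i₂, Fin.ext_iff] at h
  have h12 : i₁ ≠ i₂ := fun h => by simp [i₁, i₂, Fin.ext_iff] at h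
  obtain ⟨x, hx₀, hx₁⟩ := LineStabilizer.exists_GL_pair (linearIndependent_single h01) hv
  exact no_design_of_disjoint_conj₂₃ (disjoint_adm_transl h01 h02 h12) x htpp
    (conj_translGroup_le i₀ hx₀ hH₂) (conj_translGroup_le i₁ hx₁ hH₃)

end Exclusion

end TransvectionLines
end Summit.MatrixMultiplication.MatrixMultiplication.Theorems.SubgroupIdentityDesigns.Negative
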